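import Literature.MathematicalPhysics.KineticTheory.HardSphereTwoTimePressure
import Literature.MathematicalPhysics.KineticTheory.HardSphereEulerProofs
import Literature.MathematicalPhysics.KineticTheory.HardSphereBBGKYLiouvilleFlow
import Summits.AtomisticToContinuum.HydrodynamicLimit.Theorems.LambertianContactSwapLambertianEulerTailsZero
import Summits.AtomisticToContinuum.HydrodynamicLimit.Theorems.OneFlightGossipEngineSuperExponentialEnergyTailsDefsB
import HarnessLib

/-!
# Statics of the true-law velocity moments (stub R of line `Sketch`, crux `SuperExponentialEnergyTails`,
# stmt-AtomisticToContinuum-17701), stage 2/4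

Stub worker file for the registered stub `stub_momentRegularity : MomentRegularity` of the line lead's
skeleton `Cruxes/SuperExponentialEnergyTails/Lines/Sketch.lean` (lead prover-line-stmt-AtomisticToContinuum-17701-0).
This stage proves the four STATIC fields `mass`, `energy`, `lyapunov`, `initial` of
`SuperExponentialEnergyTailsLine.MomentRegularityFor σ a₀ u₀ θ₀` for continuous data `a₀, θ₀ > 0`, `u₀` and
`σ ≤ 1/2`, packaged as the registered helper `momentStatics` (their conjunction):

* `mass`: the order-`0` integrand is the constant `1` and `λ_N = localGibbsLaw σ a₀ u₀ θ₀ N Φ` is a probability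
  measure (`isProbabilityMeasure_localGibbsLaw`, `σ ≤ 1/2`).
* `energy`: `∑ᵢ ‖vᵢ(s)‖² = 2 E(Φ_s z) = 2 E(z) = ∑ᵢ ‖vᵢ(0)‖²` on the `λ_N`-conull good set
  (`HardSphereFlow.configEnergy_flow`, `ae_mem_good_localGibbsLaw`).
* `lyapunov`: Hölder twice with the exponents `α = (p₁−p)/(p₁−p₀)`, `β = (p−p₀)/(p₁−p₀)` (`α + β = 1`,
  `α p₀ + β p₁ = p`): on the finite particle average (`ENNReal.lintegral_mul_norm_pow_le` for the counting
  measure on `Fin (N+1)`) and on the `λ_N`-integral (`ENNReal.lintegral_mul_norm_pow_le` again) — valid for any law.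
* `initial`: `Φ_0 = id` on the good set and `‖v‖^{2k} = (‖v‖²)ᵏ ≤ k! a^{−k} e^{a‖v‖²}`, so `M_{2k}(0) ≤ K a^{−k} k!`
  with the per-particle Gaussian exponential moment
  `LambertianContactSwapLambertianEulerTailsZero.tailsZero_lintegral_exp_localGibbsLaw_le` (uniform in `N`, `Φ`).

References: Bobylev 1997, Desvillettes 1993 (moment/Povzner method: Lyapunov interpolation of the moments);
folklore measure theory otherwise.
-/

noncomputable section

open MeasureTheory Set Filter
open scoped ENNReal BigOperators

namespace Summit.AtomisticToContinuum.HydrodynamicLimit.Theorems.SuperExponentialEnergyTailsMomentRegularity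

open Literature.MathematicalPhysics.KineticTheory Literature.Analysis.FluidPDE
open Summit.AtomisticToContinuum.HydrodynamicLimit.Theorems.SuperExponentialEnergyTailsLine (velMoment)

/-! ## Mass, energy and the Gaussian initial class -/

section Gibbs

variable {a₀ θ₀ : T3 → ℝ} {u₀ : T3 → V3}

/-- **Field `mass`**: the order-`0` moment is `1` (`λ_N` is a probability measure for `σ ≤ 1/2`). [folklore] -/
theorem velMoment_zero (ha : Continuous a₀) (hθ : Continuous θ₀) (hu : Continuous u₀)
    (ha0 : ∀ x, 0 < a₀ x) (hθ0 : ∀ x, 0 < θ₀ x) {σ : ℝ} (hσ2 : σ ≤ 1 / 2) (N : ℕ)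
    (Φ : HardSphereFlow (Torus.geometry (Fin 3)) (hsDiameter σ N) (N + 1)) (s : ℝ) :
    velMoment Φ (localGibbsLaw σ a₀ u₀ θ₀ N Φ) 0 s = 1 := by
  haveI := isProbabilityMeasure_localGibbsLaw ha hθ hu ha0 hθ0 hσ2 N Φ
  have hN : (0 : ℝ) < (N : ℝ) + 1 := by positivity
  have h1 : ∀ z : Config (N + 1) (Fin 3) T3,
      ENNReal.ofReal (((N : ℝ) + 1)⁻¹ * ∑ i : Fin (N + 1), ‖(Φ.flow s z i).2‖ ^ 0) = 1 := by
    intro z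
    simp only [pow_zero, Finset.sum_const, Finset.card_univ, Fintype.card_fin, nsmul_eq_mul, mul_one,
      Nat.cast_add_one, inv_mul_cancel₀ hN.ne', ENNReal.ofReal_one]
  simp only [velMoment, h1, lintegral_const, measure_univ, mul_one]

/-- **Field `energy`**: the second moment is conserved (`configEnergy_flow`, `flow_zero` on the good set).
[folklore] -/
theorem velMoment_two (σ : ℝ) (a₀ θ₀ : T3 → ℝ) (u₀ : T3 → V3) (N : ℕ)
    (Φ : HardSphereFlow (Torus.geometry (Fin 3)) (hsDiameter σ N) (N + 1)) (s : ℝ) :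
    velMoment Φ (localGibbsLaw σ a₀ u₀ θ₀ N Φ) 2 s = velMoment Φ (localGibbsLaw σ a₀ u₀ θ₀ N Φ) 2 0 := by
  refine lintegral_congr_ae ?_
  filter_upwards [ae_mem_good_localGibbsLaw σ a₀ u₀ θ₀ N Φ] with z hz
  have hs := Φ.configEnergy_flow hz s
  have h0 := Φ.configEnergy_flow hz 0
  simp only [configEnergy] at hs h0
  have h : ∑ i, ‖(Φ.flow s z i).2‖ ^ 2 = ∑ i, ‖(Φ.flow 0 z i).2‖ ^ 2 := by
    have := hs.trans h0.symm
    have h2 := congrArg (fun x : ℝ => 2 * x) this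
    simpa only [← mul_assoc, mul_inv_cancel₀ (two_ne_zero (α := ℝ)), one_mul] using h2
  rw [h]

/-- **Field `initial`**: the Gaussian class of the initial even moments, uniformly in `N` and `Φ`:
`M_{2k}(0) ≤ C₀ A₀ᵏ k!` with `A₀ = a⁻¹`, `C₀ = max K 1` from the per-particle exponential moment
(`Φ_0 = id` on the good set, `‖v‖^{2k} = (‖v‖²)ᵏ ≤ k! a^{−k} e^{a‖v‖²}`). [folklore] -/
theorem velMoment_initial (ha : Continuous a₀) (hθ : Continuous θ₀) (hu : Continuous u₀)
    (ha0 : ∀ x, 0 < a₀ x) (hθ0 : ∀ x, 0 < θ₀ x) {σ : ℝ} (hσ2 : σ ≤ 1 / 2) :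
    ∃ C₀ : ℝ, 0 < C₀ ∧ ∃ A₀ : ℝ, 0 < A₀ ∧
      ∀ (N : ℕ) (Φ : HardSphereFlow (Torus.geometry (Fin 3)) (hsDiameter σ N) (N + 1)) (k : ℕ),
        velMoment Φ (localGibbsLaw σ a₀ u₀ θ₀ N Φ) (2 * k) 0
          ≤ ENNReal.ofReal (C₀ * A₀ ^ k * (k.factorial : ℝ)) := by
  obtain ⟨a, ha_pos, K, hK⟩ :=
    LambertianContactSwapLambertianEulerTailsZero.tailsZero_exists_lintegral_exp_gaussMeasure_le hθ hu hθ0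
  refine ⟨max K 1, by positivity, a⁻¹, inv_pos.2 ha_pos, fun N Φ k => ?_⟩
  have hKi := fun i : Fin (N + 1) =>
    LambertianContactSwapLambertianEulerTailsZero.tailsZero_lintegral_exp_localGibbsLaw_le
      ha hθ hu ha0 hθ0 hK hσ2 N Φ i
  have hN : (0 : ℝ) < (N : ℝ) + 1 := by positivity
  have hak : 0 < a ^ k := pow_pos ha_pos k
  -- the pointwise constant
  set c : ℝ := ((N : ℝ) + 1)⁻¹ * ((k.factorial : ℝ) * (a ^ k)⁻¹) with hc
  have hc0 : 0 ≤ c := by positivity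
  have hmi : ∀ i : Fin (N + 1), Measurable fun z : Config (N + 1) (Fin 3) T3 =>
      ENNReal.ofReal (Real.exp (a * ‖(z i).2‖ ^ 2)) := fun i =>
    (Real.measurable_exp.comp ((measurable_norm.pow_const 2).const_mul a)).ennreal_ofReal.comp
      (measurable_pi_apply i).snd
  -- `‖v‖^{2k} ≤ k! a^{-k} exp (a ‖v‖²)`
  have hv : ∀ v : V3, ‖v‖ ^ (2 * k) ≤ (k.factorial : ℝ) * (a ^ k)⁻¹ * Real.exp (a * ‖v‖ ^ 2) := by
    intro v
    have h := Real.pow_div_factorial_le_exp (a * ‖v‖ ^ 2) (by positivity) k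
    rw [div_le_iff₀ (by positivity : (0 : ℝ) < k.factorial), mul_pow] at h
    calc ‖v‖ ^ (2 * k) = (a ^ k)⁻¹ * (a ^ k * (‖v‖ ^ 2) ^ k) := by
          rw [← mul_assoc, inv_mul_cancel₀ hak.ne', one_mul, pow_mul]
      _ ≤ (a ^ k)⁻¹ * (Real.exp (a * ‖v‖ ^ 2) * k.factorial) :=
          mul_le_mul_of_nonneg_left h (inv_nonneg.2 hak.le)
      _ = (k.factorial : ℝ) * (a ^ k)⁻¹ * Real.exp (a * ‖v‖ ^ 2) := by ring
  have hpt : ∀ z ∈ Φ.good,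
      ENNReal.ofReal (((N : ℝ) + 1)⁻¹ * ∑ i : Fin (N + 1), ‖(Φ.flow 0 z i).2‖ ^ (2 * k)) ≤
        ENNReal.ofReal c * ∑ i : Fin (N + 1), ENNReal.ofReal (Real.exp (a * ‖(z i).2‖ ^ 2)) := by
    intro z hz
    rw [Φ.flow_zero z hz, ← ENNReal.ofReal_sum_of_nonneg fun i _ => (Real.exp_pos _).le,
      ← ENNReal.ofReal_mul hc0]
    refine ENNReal.ofReal_le_ofReal ?_
    calc ((N : ℝ) + 1)⁻¹ * ∑ i, ‖(z i).2‖ ^ (2 * k)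
        ≤ ((N : ℝ) + 1)⁻¹ * ∑ i, (k.factorial : ℝ) * (a ^ k)⁻¹ * Real.exp (a * ‖(z i).2‖ ^ 2) :=
          mul_le_mul_of_nonneg_left (Finset.sum_le_sum fun i _ => hv _) (inv_nonneg.2 hN.le)
      _ = c * ∑ i, Real.exp (a * ‖(z i).2‖ ^ 2) := by
          rw [hc, mul_assoc, ← Finset.mul_sum]
  calc velMoment Φ (localGibbsLaw σ a₀ u₀ θ₀ N Φ) (2 * k) 0
      ≤ ∫⁻ z, ENNReal.ofReal c * ∑ i : Fin (N + 1), ENNReal.ofReal (Real.exp (a * ‖(z i).2‖ ^ 2))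
          ∂(localGibbsLaw σ a₀ u₀ θ₀ N Φ) := by
        refine lintegral_mono_ae ?_
        filter_upwards [ae_mem_good_localGibbsLaw σ a₀ u₀ θ₀ N Φ] with z hz
        exact hpt z hz
    _ = ENNReal.ofReal c * ∑ i : Fin (N + 1), ∫⁻ z, ENNReal.ofReal (Real.exp (a * ‖(z i).2‖ ^ 2))
          ∂(localGibbsLaw σ a₀ u₀ θ₀ N Φ) := by
        rw [lintegral_const_mul _ (Finset.measurable_sum _ fun i _ => hmi i),
          lintegral_finsetSum _ fun i _ => hmi i]
    _ ≤ ENNReal.ofReal c * ∑ _i : Fin (N + 1), ENNReal.ofReal (max K 1) := by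
        gcongr with i
        exact (hKi i).trans (ENNReal.ofReal_le_ofReal (le_max_left _ _))
    _ = ENNReal.ofReal (max K 1 * a⁻¹ ^ k * (k.factorial : ℝ)) := by
        rw [Finset.sum_const, Finset.card_univ, Fintype.card_fin, nsmul_eq_mul,
          ← ENNReal.ofReal_natCast (N + 1), ← ENNReal.ofReal_mul (by positivity), ← ENNReal.ofReal_mul hc0,
          hc]
        congr 1
        push_cast
        rw [inv_pow]
        field_simp

end Gibbs

/-! ## Lyapunov's interpolation -/

section Lyapunov

/-- Hölder on a finite family with exponents summing to one:
`∑ᵢ fᵢ^α gᵢ^β ≤ (∑ᵢ fᵢ)^α (∑ᵢ gᵢ)^β` (`ENNReal.lintegral_mul_norm_pow_le` for the counting measure). [folklore] -/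
theorem sum_rpow_mul_rpow_le {ι : Type*} [Fintype ι] (f g : ι → ℝ≥0∞) {α β : ℝ} (hα : 0 ≤ α)
    (hβ : 0 ≤ β) (hαβ : α + β = 1) :
    ∑ i, f i ^ α * g i ^ β ≤ (∑ i, f i) ^ α * (∑ i, g i) ^ β := by
  letI : MeasurableSpace ι := ⊤
  haveI : MeasurableSingletonClass ι := ⟨fun _ => trivial⟩
  have h := ENNReal.lintegral_mul_norm_pow_le (μ := (Measure.count : Measure ι)) (f := f) (g := g)
    (Measurable.of_discrete).aemeasurable (Measurable.of_discrete).aemeasurable hα hβ hαβ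
  simpa only [lintegral_fintype, Measure.count_singleton, mul_one] using h

/-- The exponent bookkeeping of Lyapunov's inequality: for `p₀ < p < p₁`,
`(x^{p₀})^{(p₁−p)/(p₁−p₀)} (x^{p₁})^{(p−p₀)/(p₁−p₀)} = xᵖ` in `ℝ≥0∞`. [folklore] -/
theorem rpow_interpolate (x : ℝ≥0∞) {p₀ p p₁ : ℕ} (h₀ : p₀ < p) (h₁ : p < p₁) :
    (x ^ p₀) ^ (((p₁ : ℝ) - p) / ((p₁ : ℝ) - p₀)) * (x ^ p₁) ^ (((p : ℝ) - p₀) / ((p₁ : ℝ) - p₀))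
      = x ^ p := by
  have h₀' : (p₀ : ℝ) < p := by exact_mod_cast h₀
  have h₁' : (p : ℝ) < p₁ := by exact_mod_cast h₁
  have hd : (0 : ℝ) < (p₁ : ℝ) - p₀ := by linarith
  have hA : 0 ≤ ((p₁ : ℝ) - p) / ((p₁ : ℝ) - p₀) := div_nonneg (by linarith) hd.le
  have hB : 0 ≤ ((p : ℝ) - p₀) / ((p₁ : ℝ) - p₀) := div_nonneg (by linarith) hd.le
  rw [← ENNReal.rpow_natCast x p₀, ← ENNReal.rpow_natCast x p₁, ← ENNReal.rpow_mul, ← ENNReal.rpow_mul,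
    ← ENNReal.rpow_add_of_nonneg _ _ (mul_nonneg (Nat.cast_nonneg _) hA)
      (mul_nonneg (Nat.cast_nonneg _) hB), ← ENNReal.rpow_natCast x p]
  congr 1
  field_simp
  ring

/-- **Lyapunov's inequality for a finite average**: for `p₀ < p < p₁` and `xᵢ ∈ ℝ≥0∞`, `c ∈ ℝ≥0∞`,
`c ∑ᵢ xᵢᵖ ≤ (c ∑ᵢ xᵢ^{p₀})^α (c ∑ᵢ xᵢ^{p₁})^β`, `α = (p₁−p)/(p₁−p₀)`, `β = (p−p₀)/(p₁−p₀)`. [folklore] -/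
theorem mul_sum_pow_le_lyapunov {ι : Type*} [Fintype ι] (c : ℝ≥0∞) (x : ι → ℝ≥0∞) {p₀ p p₁ : ℕ}
    (h₀ : p₀ < p) (h₁ : p < p₁) :
    c * ∑ i, x i ^ p ≤
      (c * ∑ i, x i ^ p₀) ^ (((p₁ : ℝ) - p) / ((p₁ : ℝ) - p₀)) *
        (c * ∑ i, x i ^ p₁) ^ (((p : ℝ) - p₀) / ((p₁ : ℝ) - p₀)) := by
  have h₀' : (p₀ : ℝ) < p := by exact_mod_cast h₀
  have h₁' : (p : ℝ) < p₁ := by exact_mod_cast h₁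
  have hd : (0 : ℝ) < (p₁ : ℝ) - p₀ := by linarith
  have hA : 0 ≤ ((p₁ : ℝ) - p) / ((p₁ : ℝ) - p₀) := div_nonneg (by linarith) hd.le
  have hB : 0 ≤ ((p : ℝ) - p₀) / ((p₁ : ℝ) - p₀) := div_nonneg (by linarith) hd.le
  have hAB : ((p₁ : ℝ) - p) / ((p₁ : ℝ) - p₀) + ((p : ℝ) - p₀) / ((p₁ : ℝ) - p₀) = 1 := by
    field_simp
    ring
  have hc : c = c ^ (((p₁ : ℝ) - p) / ((p₁ : ℝ) - p₀)) * c ^ (((p : ℝ) - p₀) / ((p₁ : ℝ) - p₀)) := by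
    rw [← ENNReal.rpow_add_of_nonneg _ _ hA hB, hAB, ENNReal.rpow_one]
  calc c * ∑ i, x i ^ p
      = c * ∑ i, (x i ^ p₀) ^ (((p₁ : ℝ) - p) / ((p₁ : ℝ) - p₀)) *
          (x i ^ p₁) ^ (((p : ℝ) - p₀) / ((p₁ : ℝ) - p₀)) := by
        simp only [rpow_interpolate _ h₀ h₁]
    _ ≤ c * ((∑ i, x i ^ p₀) ^ (((p₁ : ℝ) - p) / ((p₁ : ℝ) - p₀)) *
          (∑ i, x i ^ p₁) ^ (((p : ℝ) - p₀) / ((p₁ : ℝ) - p₀))) := by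
        gcongr
        exact sum_rpow_mul_rpow_le _ _ hA hB hAB
    _ = _ := by
        rw [ENNReal.mul_rpow_of_nonneg _ _ hA, ENNReal.mul_rpow_of_nonneg _ _ hB]
        conv_lhs => rw [hc]
        ring

variable {N : ℕ} {ε : ℝ}

/-- The moment integrand in product form: `ofReal ((N+1)⁻¹ ∑ᵢ ‖vᵢ‖^q) = ofReal ((N+1)⁻¹) ∑ᵢ (ofReal ‖vᵢ‖)^q`.
[folklore] -/
theorem ofReal_avg_powSum_eq (Φ : HardSphereFlow (Torus.geometry (Fin 3)) ε (N + 1))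
    (z : Config (N + 1) (Fin 3) T3) (q : ℕ) (s : ℝ) :
    ENNReal.ofReal (((N : ℝ) + 1)⁻¹ * ∑ i : Fin (N + 1), ‖(Φ.flow s z i).2‖ ^ q) =
      ENNReal.ofReal (((N : ℝ) + 1)⁻¹) * ∑ i : Fin (N + 1), ENNReal.ofReal ‖(Φ.flow s z i).2‖ ^ q := by
  rw [ENNReal.ofReal_mul (by positivity), ENNReal.ofReal_sum_of_nonneg fun i _ => by positivity]
  congr 1
  exact Finset.sum_congr rfl fun i _ => ENNReal.ofReal_pow (norm_nonneg _) q

/-- Measurability of the normalised power integrand along the flow (private copy: the sibling stage files of stub R are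
import-unreachable at submission time). [folklore] -/
private theorem measurable_ofReal_avg_powSum (Φ : HardSphereFlow (Torus.geometry (Fin 3)) ε (N + 1)) (q : ℕ)
    (s : ℝ) : Measurable fun z : Config (N + 1) (Fin 3) T3 =>
      ENNReal.ofReal (((N : ℝ) + 1)⁻¹ * ∑ i : Fin (N + 1), ‖(Φ.flow s z i).2‖ ^ q) := by
  refine ENNReal.measurable_ofReal.comp (Measurable.const_mul ?_ _)
  refine Finset.measurable_sum _ fun i _ => ?_
  exact (((measurable_pi_apply i).comp (Φ.measurable_flow s)).snd.norm).pow_const q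

/-- **Field `lyapunov`**: `M_p ≤ M_{p₀}^{(p₁−p)/(p₁−p₀)} M_{p₁}^{(p−p₀)/(p₁−p₀)}` for `p₀ < p < p₁` and any law
`P` (Hölder on the particle average, then on the integral). [folklore] -/
theorem velMoment_lyapunov (Φ : HardSphereFlow (Torus.geometry (Fin 3)) ε (N + 1))
    (P : Measure (Config (N + 1) (Fin 3) T3)) {p₀ p p₁ : ℕ} (h₀ : p₀ < p) (h₁ : p < p₁) (s : ℝ) :
    velMoment Φ P p s ≤
      velMoment Φ P p₀ s ^ (((p₁ : ℝ) - p) / ((p₁ : ℝ) - p₀)) *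
        velMoment Φ P p₁ s ^ (((p : ℝ) - p₀) / ((p₁ : ℝ) - p₀)) := by
  have h₀' : (p₀ : ℝ) < p := by exact_mod_cast h₀
  have h₁' : (p : ℝ) < p₁ := by exact_mod_cast h₁
  have hd : (0 : ℝ) < (p₁ : ℝ) - p₀ := by linarith
  have hA : 0 ≤ ((p₁ : ℝ) - p) / ((p₁ : ℝ) - p₀) := div_nonneg (by linarith) hd.le
  have hB : 0 ≤ ((p : ℝ) - p₀) / ((p₁ : ℝ) - p₀) := div_nonneg (by linarith) hd.le
  have hAB : ((p₁ : ℝ) - p) / ((p₁ : ℝ) - p₀) + ((p : ℝ) - p₀) / ((p₁ : ℝ) - p₀) = 1 := by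
    field_simp
    ring
  simp only [velMoment]
  calc ∫⁻ z, ENNReal.ofReal (((N : ℝ) + 1)⁻¹ * ∑ i : Fin (N + 1), ‖(Φ.flow s z i).2‖ ^ p) ∂P
      ≤ ∫⁻ z, ENNReal.ofReal (((N : ℝ) + 1)⁻¹ * ∑ i : Fin (N + 1), ‖(Φ.flow s z i).2‖ ^ p₀)
            ^ (((p₁ : ℝ) - p) / ((p₁ : ℝ) - p₀)) *
          ENNReal.ofReal (((N : ℝ) + 1)⁻¹ * ∑ i : Fin (N + 1), ‖(Φ.flow s z i).2‖ ^ p₁)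
            ^ (((p : ℝ) - p₀) / ((p₁ : ℝ) - p₀)) ∂P := by
        refine lintegral_mono fun z => ?_
        simp only [ofReal_avg_powSum_eq]
        exact mul_sum_pow_le_lyapunov _ _ h₀ h₁
    _ ≤ _ := ENNReal.lintegral_mul_norm_pow_le (measurable_ofReal_avg_powSum Φ p₀ s).aemeasurable
          (measurable_ofReal_avg_powSum Φ p₁ s).aemeasurable hA hB hAB

end Lyapunov

/-! ## The registered helper -/

/-- **Stage 2 of stub R — THE STATIC FIELDS of `MomentRegularityFor`**, registered helper `momentStatics` of
`stub_momentRegularity` (line `Sketch`, crux stmt-AtomisticToContinuum-17701): for continuous data `a₀, θ₀ > 0`,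
`u₀` and `σ ≤ 1/2`, the moments `M_p(s) = velMoment Φ λ_N p s` of the local Gibbs law transported by any
hard-sphere flow satisfy `M_0 ≡ 1` (mass), `M_2(s) = M_2(0)` (energy conservation), Lyapunov's interpolation
`M_p ≤ M_{p₀}^{(p₁−p)/(p₁−p₀)} M_{p₁}^{(p−p₀)/(p₁−p₀)}` for `p₀ < p < p₁`, and the Gaussian initial class
`M_{2k}(0) ≤ C₀ A₀ᵏ k!` with `C₀, A₀` depending on the data only. [folklore] -/
theorem momentStatics :
    ∀ (a₀ θ₀ : T3 → ℝ) (u₀ : T3 → V3), Continuous a₀ → Continuous θ₀ → Continuous u₀ →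
      (∀ x, 0 < a₀ x) → (∀ x, 0 < θ₀ x) → ∀ σ : ℝ, σ ≤ 1 / 2 →
        (∀ (N : ℕ) (Φ : HardSphereFlow (Torus.geometry (Fin 3)) (hsDiameter σ N) (N + 1)) (s : ℝ),
          velMoment Φ (localGibbsLaw σ a₀ u₀ θ₀ N Φ) 0 s = 1) ∧
        (∀ (N : ℕ) (Φ : HardSphereFlow (Torus.geometry (Fin 3)) (hsDiameter σ N) (N + 1)) (s : ℝ),
          velMoment Φ (localGibbsLaw σ a₀ u₀ θ₀ N Φ) 2 s = velMoment Φ (localGibbsLaw σ a₀ u₀ θ₀ N Φ) 2 0) ∧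
        (∀ (N : ℕ) (Φ : HardSphereFlow (Torus.geometry (Fin 3)) (hsDiameter σ N) (N + 1)) (p₀ p p₁ : ℕ),
          p₀ < p → p < p₁ → ∀ s : ℝ,
            velMoment Φ (localGibbsLaw σ a₀ u₀ θ₀ N Φ) p s
              ≤ velMoment Φ (localGibbsLaw σ a₀ u₀ θ₀ N Φ) p₀ s ^ (((p₁ : ℝ) - p) / ((p₁ : ℝ) - p₀))
                * velMoment Φ (localGibbsLaw σ a₀ u₀ θ₀ N Φ) p₁ s ^ (((p : ℝ) - p₀) / ((p₁ : ℝ) - p₀))) ∧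
        (∃ C₀ : ℝ, 0 < C₀ ∧ ∃ A₀ : ℝ, 0 < A₀ ∧
          ∀ (N : ℕ) (Φ : HardSphereFlow (Torus.geometry (Fin 3)) (hsDiameter σ N) (N + 1)) (k : ℕ),
            velMoment Φ (localGibbsLaw σ a₀ u₀ θ₀ N Φ) (2 * k) 0
              ≤ ENNReal.ofReal (C₀ * A₀ ^ k * (k.factorial : ℝ))) := by
  intro a₀ θ₀ u₀ ha hθ hu ha0 hθ0 σ hσ2
  exact ⟨velMoment_zero ha hθ hu ha0 hθ0 hσ2, velMoment_two σ a₀ θ₀ u₀,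
    fun N Φ p₀ p p₁ h₀ h₁ s => velMoment_lyapunov Φ _ h₀ h₁ s, velMoment_initial ha hθ hu ha0 hθ0 hσ2⟩

end Summit.AtomisticToContinuum.HydrodynamicLimit.Theorems.SuperExponentialEnergyTailsMomentRegularity

end
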